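import Literature.NumberTheory.Sieve.RosserSievePartialSummation
import HarnessLib

/-!
# Partial summation under the linear-sieve condition (9.29): Nathanson's Lemma 9.8

Topic `Literature/NumberTheory/Sieve`; first file of the explicit form of the Jurkat–Richert
theorem following M. B. Nathanson, *Additive Number Theory: The Classical Bases*, GTM 164 (1996),
Ch. 9, §9.4 (PDF p. 157 of the held copy) [Nathanson1996]. Companion of
`RosserSievePartialSummation.lean` (Iwaniec's Lemma 21 = the same Abel summation under the
regular condition `Ω(κ, L)`), whose discrete Abel machinery (`Abel.sum_sub_mul_le`,
`BetaSieve.sum_primes_eq_sum_Ico`, `BetaSieve.vprod_natCast_sub_succ`) is reused here.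

**Lemma 9.8** (Nathanson, p. 254 of the book): let `z ≥ 2`, `1 < w < z`, let `g` be multiplicative
with `0 ≤ g(p) < 1` on the sieving range and
`∏_{u ≤ p < z} (1 − g(p))⁻¹ ≤ K log z / log u` for all `1 < u < z` (9.29), `V(z) = ∏_{p<z} (1 − g(p))`,
and let `Φ` be continuous and increasing on `[w, z]`. Then
`∑_{w ≤ p < z} g(p) V(p) Φ(p) ≤ (K − 1) V(z) Φ(z) − K V(z) ∫_w^z Φ(u) d(log z/log u)`.

Here (9.29) is used only through its consequence `V(u) ≤ K (log z/log u) V(z)` for `1 < u < z`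
(which is how Nathanson's proof uses it: `S(u) = V(u) − V(z) ≤ (K log z/log u − 1) V(z)`), and
`−d(log z/log u) = (log z) du/(u log² u)`; so the statement PROVED is

`∑_{w ≤ p < z} g(p) V(P(p)) Φ(p) ≤ V(P(z)) ((K − 1) Φ(z) + ∫_w^z Φ(x) K log z/(x log² x) dx)`

(`BetaSieve.sum_primes_le_of_kTail`; `V(P(x)) = BetaSieve.vprod g (primesProdBelow x)`), for any
arithmetic function `g` (multiplicativity and `g ≥ 0` are not needed for the summation itself),
`1 < w ≤ z`, `K ≥ 1`, `V(P(z)) ≥ 0`, and `Φ ≥ 0` continuous and non-decreasing on `[w, z]`. The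
hypothesis `Φ ≥ 0` is NOT printed but is necessary (`Φ ≡ −1` would give
`S(w) ≥ (K log z/log w − 1) V(z)`, false in general); Nathanson's proof uses it silently at the term
`S(w)Φ(w)`, and it holds in his only application `Φ = f_{n−1} + h_{n−1} ≥ 0`. The
substitution `t = log D/log x` that Nathanson performs next (proof of Theorem 9.5, p. 256:
`∫_1^z Φ(u) d(log D/log u) = −∫_s^∞ …`) is `BetaSieve.integral_comp_logRatio_mul_kTailDeriv`:
`∫_w^z Ψ(log D/log x) K log z dx/(x log² x) = K (log z/log D) ∫_{log D/log z}^{log D/log w} Ψ(t) dt`.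

## References

* M. B. Nathanson, *Additive Number Theory: The Classical Bases*, GTM 164, Springer (1996), Ch. 9,
  Lemma 9.8 and the proof of Theorem 9.5. [Nathanson1996]
* H. Iwaniec, *Rosser's sieve*, Acta Arith. 36 (1980), 171–202, Lemma 21. [IwaniecActaArith1980]
-/

open Finset Set MeasureTheory intervalIntegral

noncomputable section

namespace Literature.NumberTheory.Sieve

namespace BetaSieve

/-! ### The weight `U(x) = K log z/log x − 1` and its derivative -/

/-- `U(x) = K log z / log x − 1`, the bound for the normalised tail `V(P(x))/V(P(z)) − 1` furnished by
Nathanson's condition (9.29) (proof of Lemma 9.8: `S(u) ≤ (K log z/log u − 1) V(z)`).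
[cite: Nathanson1996, Lemma 9.8] -/
def kTail (K z x : ℝ) : ℝ :=
  K * Real.log z / Real.log x - 1

/-- `u(x) = −U'(x) = K log z/(x log² x)` (`= −K d(log z/log x)/dx`). [cite: Nathanson1996, Lemma 9.8] -/
def kTailDeriv (K z x : ℝ) : ℝ :=
  K * Real.log z / (x * Real.log x ^ 2)

/-- Unfolding lemma for `kTail`. [folklore] -/
theorem kTail_def (K z x : ℝ) : kTail K z x = K * Real.log z / Real.log x - 1 := rfl

/-- Unfolding lemma for `kTailDeriv`. [folklore] -/
theorem kTailDeriv_def (K z x : ℝ) : kTailDeriv K z x = K * Real.log z / (x * Real.log x ^ 2) := rfl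

/-- `U' = −u` on `(1, ∞)`. [folklore] -/
theorem hasDerivAt_kTail (K z : ℝ) {x : ℝ} (hx : 1 < x) :
    HasDerivAt (kTail K z) (-kTailDeriv K z x) x := by
  have hx0 : x ≠ 0 := by positivity
  have hlog : 0 < Real.log x := Real.log_pos hx
  have h1 : HasDerivAt Real.log x⁻¹ x := Real.hasDerivAt_log hx0
  have h2 : HasDerivAt (fun y => (Real.log y)⁻¹) (-(x⁻¹) / Real.log x ^ 2) x := h1.inv hlog.ne'
  have h3 : HasDerivAt (fun y => K * Real.log z * (Real.log y)⁻¹ - 1)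
      (K * Real.log z * (-(x⁻¹) / Real.log x ^ 2)) x := (h2.const_mul _).sub_const 1
  have heq : (fun y => K * Real.log z * (Real.log y)⁻¹ - 1) = kTail K z := by
    funext y; rw [kTail, div_eq_mul_inv]
  rw [heq] at h3
  refine h3.congr_deriv ?_
  rw [kTailDeriv]
  field_simp

/-- `u ≥ 0` on `(1, ∞)` for `K ≥ 0`, `z ≥ 1`. [folklore] -/
theorem kTailDeriv_nonneg {K z x : ℝ} (hK : 0 ≤ K) (hz : 1 ≤ z) (hx : 1 < x) :
    0 ≤ kTailDeriv K z x := by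
  have hlog : 0 < Real.log x := Real.log_pos hx
  have hlogz : 0 ≤ Real.log z := Real.log_nonneg hz
  unfold kTailDeriv
  positivity

/-- `U(z) = K − 1` for `z > 1`. [folklore] -/
theorem kTail_self {K z : ℝ} (hz : 1 < z) : kTail K z z = K - 1 := by
  have hlog : Real.log z ≠ 0 := (Real.log_pos hz).ne'
  rw [kTail, mul_div_assoc, div_self hlog, mul_one]

/-- `U` is continuous on `[c, d]` for `c > 1`. [folklore] -/
theorem continuousOn_kTail (K z : ℝ) {c d : ℝ} (hc : 1 < c) :
    ContinuousOn (kTail K z) (Icc c d) := fun _ hx =>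
  ((hasDerivAt_kTail K z (lt_of_lt_of_le hc hx.1)).continuousAt).continuousWithinAt

/-- `u` is continuous on `[c, d]` for `c > 1`. [folklore] -/
theorem continuousOn_kTailDeriv (K z : ℝ) {c d : ℝ} (hc : 1 < c) :
    ContinuousOn (kTailDeriv K z) (Icc c d) := by
  have h : ContinuousOn (fun x : ℝ => x * Real.log x ^ 2) (Icc c d) :=
    continuousOn_mul_log_pow 2 (by linarith)
  refine continuousOn_const.div h fun x hx => mul_log_pow_ne_zero 2 hc hx.1

/-- `u` is integrable on `[c, d]` for `1 < c ≤ d`. [folklore] -/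
theorem intervalIntegrable_kTailDeriv (K z : ℝ) {c d : ℝ} (hc : 1 < c) (hcd : c ≤ d) :
    IntervalIntegrable (kTailDeriv K z) volume c d := by
  refine ContinuousOn.intervalIntegrable ?_
  rw [uIcc_of_le hcd]
  exact continuousOn_kTailDeriv K z hc

/-- FTC: `U(c) − U(d) = ∫_c^d u` for `1 < c ≤ d`. [folklore] -/
theorem kTail_sub_eq_integral (K z : ℝ) {c d : ℝ} (hc : 1 < c) (hcd : c ≤ d) :
    kTail K z c - kTail K z d = ∫ x in c..d, kTailDeriv K z x := by
  have hint := intervalIntegrable_kTailDeriv K z hc hcd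
  have h := integral_eq_sub_of_hasDerivAt_of_le hcd (continuousOn_kTail K z hc)
    (fun x hx => hasDerivAt_kTail K z (hc.trans hx.1)) hint.neg
  rw [intervalIntegral.integral_neg] at h
  linarith

/-- `P(⌈z⌉₊) = P(z)` (both are the product of the primes `< z`). [folklore] -/
theorem primesProdBelow_natCast_ceil (z : ℝ) : primesProdBelow ((⌈z⌉₊ : ℕ) : ℝ) = primesProdBelow z := by
  rw [primesProdBelow, primesProdBelow, Nat.ceil_natCast]

variable {g : ArithmeticFunction ℝ}

/-! ### Nathanson's Lemma 9.8 -/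

/-- **Partial summation under the linear-sieve condition (Nathanson's Lemma 9.8).** Let `g` be any
arithmetic function, `K ≥ 1`, `1 < w ≤ z`, suppose `V(P(z)) ≥ 0` and the consequence
`V(P(u)) ≤ K (log z/log u) V(P(z))` (`1 < u < z`) of (9.29), and let `Φ ≥ 0` be continuous and
non-decreasing on `[w, z]` (`Φ ≥ 0` is added to the printed statement: it is needed, and is used
silently in the printed proof). Then
`∑_{w ≤ p < z} g(p) V(P(p)) Φ(p) ≤ V(P(z)) ((K − 1) Φ(z) + ∫_w^z Φ(x) K log z dx/(x log² x))`,
i.e. Nathanson's `(K − 1) V(z) Φ(z) − K V(z) ∫_w^z Φ(u) d(log z/log u)`. Proof as printed (Abel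
summation with `S(u) = V(u) − V(z) ≤ (K log z/log u − 1) V(z)` and an integration by parts), run
over the integers as in `BetaSieve.sum_primes_le_of_monotoneOn`. [cite: Nathanson1996, Lemma 9.8] -/
theorem sum_primes_le_of_kTail {K w z : ℝ} (hK : 1 ≤ K) (hw : 1 < w) (hwz : w ≤ z)
    (hVz : 0 ≤ vprod g (primesProdBelow z))
    (hV : ∀ u : ℝ, 1 < u → u < z →
      vprod g (primesProdBelow u) ≤ K * (Real.log z / Real.log u) * vprod g (primesProdBelow z))
    {Φ : ℝ → ℝ} (hΦ0 : ∀ x ∈ Icc w z, 0 ≤ Φ x) (hΦm : MonotoneOn Φ (Icc w z))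
    (hΦc : ContinuousOn Φ (Icc w z)) :
    ∑ p ∈ Nat.primesBelow ⌈z⌉₊ with w ≤ ((p : ℕ) : ℝ), g p * vprod g (primesProdBelow p) * Φ p ≤
      vprod g (primesProdBelow z) * ((K - 1) * Φ z + ∫ x in w..z, Φ x * kTailDeriv K z x) := by
  set b : ℕ := ⌈z⌉₊ with hb
  set a : ℕ := ⌈w⌉₊ with ha
  set T : ℕ → ℝ := fun n => vprod g (primesProdBelow n) with hT
  set Tz := vprod g (primesProdBelow z) with hTz
  set u := kTailDeriv K z with hu
  set U := kTail K z with hU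
  have hz1 : 1 < z := by linarith
  have hw1 : 1 < w := hw
  have hz0 : 0 ≤ z := by linarith
  have hK0 : 0 ≤ K := by linarith
  have haw : w ≤ a := Nat.le_ceil w
  have hTb : T b = Tz := by
    simp only [hT, hTz, hb]
    rw [primesProdBelow_natCast_ceil]
  -- nonnegativity of the integrand and of the right-hand side
  have hu0 : ∀ x, w ≤ x → 0 ≤ u x := fun x hx =>
    kTailDeriv_nonneg hK0 hz1.le (by linarith)
  have hΦu_int : ∀ c d, w ≤ c → c ≤ d → d ≤ z →
      IntervalIntegrable (fun x => Φ x * u x) volume c d := by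
    intro c d hc hcd hdz
    have hi := intervalIntegrable_kTailDeriv K z (show (1 : ℝ) < c by linarith) hcd
    refine (hi.continuousOn_mul (hΦc.mono ?_))
    rw [uIcc_of_le hcd]
    exact Icc_subset_Icc hc hdz
  have hRHS0 : 0 ≤ (K - 1) * Φ z + ∫ x in w..z, Φ x * u x := by
    have h1 : 0 ≤ (K - 1) * Φ z := mul_nonneg (by linarith) (hΦ0 z ⟨hwz, le_rfl⟩)
    have h2 : 0 ≤ ∫ x in w..z, Φ x * u x :=
      intervalIntegral.integral_nonneg hwz fun x hx => mul_nonneg (hΦ0 x hx) (hu0 x hx.1)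
    linarith
  rw [sum_primes_eq_sum_Ico]
  -- the empty case
  rcases le_or_gt b a with hba | hab
  · rw [Finset.Ico_eq_empty_of_le hba, Finset.sum_empty]
    exact mul_nonneg hVz hRHS0
  -- `b = a + k + 1`
  obtain ⟨k, hk⟩ : ∃ k, b = a + k + 1 := ⟨b - a - 1, by omega⟩
  have hnz : ∀ i ≤ k, ((a + i : ℕ) : ℝ) < z := fun i hi => by
    have h1 : ((a + i : ℕ) : ℝ) ≤ (b : ℝ) - 1 := by
      have h2 : a + i + 1 ≤ b := by omega
      have h3 := (Nat.cast_le (α := ℝ)).mpr h2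
      push_cast at h3 ⊢; linarith
    have hbz : (b : ℝ) < z + 1 := Nat.ceil_lt_add_one hz0
    linarith
  have hnw : ∀ i, w ≤ ((a + i : ℕ) : ℝ) := fun i => by
    have : (a : ℝ) ≤ ((a + i : ℕ) : ℝ) := by push_cast; linarith
    exact haw.trans this
  have hn1 : ∀ i, (1 : ℝ) < ((a + i : ℕ) : ℝ) := fun i => lt_of_lt_of_le hw1 (hnw i)
  -- reindex over `i ≤ k` and apply Abel's inequality
  rw [Finset.sum_Ico_eq_sum_range, show b - a = k + 1 by omega]
  set C : ℕ → ℝ := fun i => T (a + i) - Tz with hC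
  set Uu : ℕ → ℝ := fun i => Tz * U ((a + i : ℕ) : ℝ) with hUu
  set Ph : ℕ → ℝ := fun i => Φ ((a + i : ℕ) : ℝ) with hPh
  have hsum_eq : ∑ i ∈ range (k + 1),
      (vprod g (primesProdBelow ((a + i : ℕ) : ℝ)) -
        vprod g (primesProdBelow ((a + i + 1 : ℕ) : ℝ))) * Φ ((a + i : ℕ) : ℝ) =
      ∑ i ∈ range (k + 1), (C i - C (i + 1)) * Ph i := by
    refine Finset.sum_congr rfl fun i _ => ?_
    simp only [hC, hPh, hT, ← add_assoc]
    ring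
  rw [hsum_eq]
  have hend : C (k + 1) = 0 := by
    simp only [hC]
    rw [show a + (k + 1) = b by omega, hTb, sub_self]
  have hCU : ∀ i ≤ k, C i ≤ Uu i := by
    intro i hi
    simp only [hC, hUu, hT, hU, kTail]
    have h := hV _ (hn1 i) (hnz i hi)
    have : K * (Real.log z / Real.log ((a + i : ℕ) : ℝ)) * Tz =
        Tz * (K * Real.log z / Real.log ((a + i : ℕ) : ℝ) - 1) + Tz := by ring
    linarith
  have hmono : ∀ i < k, Ph i ≤ Ph (i + 1) := by
    intro i hi
    simp only [hPh]
    refine hΦm ⟨hnw i, (hnz i hi.le).le⟩ ⟨hnw (i + 1), (hnz (i + 1) (by omega)).le⟩ ?_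
    push_cast; linarith
  have hPh0 : 0 ≤ Ph 0 := by
    simp only [hPh]
    exact hΦ0 _ ⟨hnw 0, (hnz 0 (Nat.zero_le k)).le⟩
  refine (Abel.sum_sub_mul_le C Uu Ph k hPh0 hmono hCU hend).trans ?_
  -- convert the Abel bound into integrals
  have hstep : ∀ i < k, Ph i * (Uu i - Uu (i + 1)) ≤
      Tz * ∫ x in ((a + i : ℕ) : ℝ)..((a + (i + 1) : ℕ) : ℝ), Φ x * u x := by
    intro i hi
    have hcd : ((a + i : ℕ) : ℝ) ≤ ((a + (i + 1) : ℕ) : ℝ) := by push_cast; linarith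
    have hdz : ((a + (i + 1) : ℕ) : ℝ) ≤ z := (hnz (i + 1) (by omega)).le
    have hftc := kTail_sub_eq_integral K z (hn1 i) hcd
    simp only [hPh, hUu, hU]
    rw [← mul_sub, hftc,
      show Φ ((a + i : ℕ) : ℝ) * (Tz * ∫ x in ((a + i : ℕ) : ℝ)..((a + (i + 1) : ℕ) : ℝ),
          kTailDeriv K z x) = Tz * ∫ x in ((a + i : ℕ) : ℝ)..((a + (i + 1) : ℕ) : ℝ),
          Φ ((a + i : ℕ) : ℝ) * u x by rw [intervalIntegral.integral_const_mul]; ring]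
    refine mul_le_mul_of_nonneg_left ?_ hVz
    refine intervalIntegral.integral_mono_on hcd ?_ (hΦu_int _ _ (hnw i) hcd hdz) fun x hx => ?_
    · exact (intervalIntegrable_kTailDeriv K z (hn1 i) hcd).const_mul _
    · exact mul_le_mul_of_nonneg_right
        (hΦm ⟨hnw i, (hnz i hi.le).le⟩ ⟨(hnw i).trans hx.1, hx.2.trans hdz⟩ hx.1)
        (hu0 x ((hnw i).trans hx.1))
  have hlast : Ph k * Uu k ≤
      Tz * ((K - 1) * Φ z + ∫ x in ((a + k : ℕ) : ℝ)..z, Φ x * u x) := by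
    have hcd : ((a + k : ℕ) : ℝ) ≤ z := (hnz k le_rfl).le
    have hftc := kTail_sub_eq_integral K z (hn1 k) hcd
    rw [kTail_self hz1] at hftc
    simp only [hPh, hUu, hU]
    have hUk : kTail K z ((a + k : ℕ) : ℝ) = (K - 1) + ∫ x in ((a + k : ℕ) : ℝ)..z, u x := by
      linarith
    rw [hUk]
    have hΦk0 : 0 ≤ Φ ((a + k : ℕ) : ℝ) := hΦ0 _ ⟨hnw k, hcd⟩
    have hΦkz : Φ ((a + k : ℕ) : ℝ) ≤ Φ z := hΦm ⟨hnw k, hcd⟩ ⟨hwz, le_rfl⟩ hcd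
    have h1 : Φ ((a + k : ℕ) : ℝ) * (K - 1) ≤ (K - 1) * Φ z := by nlinarith
    have h2 : Φ ((a + k : ℕ) : ℝ) * (∫ x in ((a + k : ℕ) : ℝ)..z, u x) ≤
        ∫ x in ((a + k : ℕ) : ℝ)..z, Φ x * u x := by
      rw [← intervalIntegral.integral_const_mul]
      refine intervalIntegral.integral_mono_on hcd ?_ (hΦu_int _ _ (hnw k) hcd le_rfl)
        fun x hx => ?_
      · exact (intervalIntegrable_kTailDeriv K z (hn1 k) hcd).const_mul _
      · exact mul_le_mul_of_nonneg_right (hΦm ⟨hnw k, hcd⟩ ⟨(hnw k).trans hx.1, hx.2⟩ hx.1)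
          (hu0 x ((hnw k).trans hx.1))
    calc Φ ((a + k : ℕ) : ℝ) * (Tz * ((K - 1) + ∫ x in ((a + k : ℕ) : ℝ)..z, u x))
        = Tz * (Φ ((a + k : ℕ) : ℝ) * (K - 1) +
            Φ ((a + k : ℕ) : ℝ) * ∫ x in ((a + k : ℕ) : ℝ)..z, u x) := by ring
      _ ≤ Tz * ((K - 1) * Φ z + ∫ x in ((a + k : ℕ) : ℝ)..z, Φ x * u x) :=
        mul_le_mul_of_nonneg_left (add_le_add h1 h2) hVz
  -- sum the adjacent integrals
  have hadj : ∑ i ∈ range k, ∫ x in ((a + i : ℕ) : ℝ)..((a + (i + 1) : ℕ) : ℝ), Φ x * u x =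
      ∫ x in ((a + 0 : ℕ) : ℝ)..((a + k : ℕ) : ℝ), Φ x * u x := by
    refine intervalIntegral.sum_integral_adjacent_intervals (a := fun i => ((a + i : ℕ) : ℝ)) ?_
    intro i hi
    exact hΦu_int _ _ (hnw i) (by push_cast; linarith) (hnz (i + 1) (by omega)).le
  calc ∑ i ∈ range k, Ph i * (Uu i - Uu (i + 1)) + Ph k * Uu k
      ≤ ∑ i ∈ range k, (Tz * ∫ x in ((a + i : ℕ) : ℝ)..((a + (i + 1) : ℕ) : ℝ), Φ x * u x) +
          Tz * ((K - 1) * Φ z + ∫ x in ((a + k : ℕ) : ℝ)..z, Φ x * u x) :=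
        add_le_add (Finset.sum_le_sum fun i hi => hstep i (mem_range.mp hi)) hlast
    _ = Tz * ((K - 1) * Φ z + ∫ x in ((a + 0 : ℕ) : ℝ)..z, Φ x * u x) := by
        rw [← Finset.mul_sum, hadj, ← intervalIntegral.integral_add_adjacent_intervals
          (hΦu_int _ _ (hnw 0) (by push_cast; linarith) (hnz k le_rfl).le)
          (hΦu_int _ _ (hnw k) (hnz k le_rfl).le le_rfl)]
        ring
    _ ≤ Tz * ((K - 1) * Φ z + ∫ x in w..z, Φ x * u x) := by
        refine mul_le_mul_of_nonneg_left (add_le_add le_rfl ?_) hVz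
        refine intervalIntegral.integral_mono_interval (hnw 0) (hnz 0 (Nat.zero_le k)).le le_rfl
          ?_ (hΦu_int _ _ le_rfl hwz le_rfl)
        refine (ae_restrict_mem measurableSet_Ioc).mono fun x hx => ?_
        exact mul_nonneg (hΦ0 x ⟨hx.1.le, hx.2⟩) (hu0 x hx.1.le)

/-- The same bound for the sum over ALL primes `p < z` (take `w = 2 ≤ z`; there are no primes below
`2`). [cite: Nathanson1996, Lemma 9.8] -/
theorem sum_primesBelow_le_of_kTail {K z : ℝ} (hK : 1 ≤ K) (hz : 2 ≤ z)
    (hVz : 0 ≤ vprod g (primesProdBelow z))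
    (hV : ∀ u : ℝ, 1 < u → u < z →
      vprod g (primesProdBelow u) ≤ K * (Real.log z / Real.log u) * vprod g (primesProdBelow z))
    {Φ : ℝ → ℝ} (hΦ0 : ∀ x ∈ Icc 2 z, 0 ≤ Φ x) (hΦm : MonotoneOn Φ (Icc 2 z))
    (hΦc : ContinuousOn Φ (Icc 2 z)) :
    ∑ p ∈ Nat.primesBelow ⌈z⌉₊, g p * vprod g (primesProdBelow p) * Φ p ≤
      vprod g (primesProdBelow z) * ((K - 1) * Φ z + ∫ x in (2 : ℝ)..z, Φ x * kTailDeriv K z x) := by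
  have h := sum_primes_le_of_kTail hK one_lt_two hz hVz hV hΦ0 hΦm hΦc
  rwa [Finset.filter_true_of_mem] at h
  intro p hp
  exact_mod_cast (Nat.prime_of_mem_primesBelow hp).two_le

/-! ### The substitution `t = log D/log x` -/

/-- The map `x ↦ log D/log x` has derivative `−log D/(x log² x)` at `x > 1`. [folklore] -/
theorem hasDerivAt_logRatio (D : ℝ) {x : ℝ} (hx : 1 < x) :
    HasDerivAt (fun y : ℝ => Real.log D / Real.log y) (-(Real.log D / (x * Real.log x ^ 2))) x := by
  have hx0 : x ≠ 0 := by positivity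
  have hlog : 0 < Real.log x := Real.log_pos hx
  have h1 : HasDerivAt Real.log x⁻¹ x := Real.hasDerivAt_log hx0
  have h2 : HasDerivAt (fun y => (Real.log y)⁻¹) (-(x⁻¹) / Real.log x ^ 2) x := h1.inv hlog.ne'
  have h3 := h2.const_mul (Real.log D)
  have heq : (fun y => Real.log D * (Real.log y)⁻¹) = fun y => Real.log D / Real.log y := by
    funext y; rw [div_eq_mul_inv]
  rw [heq] at h3
  refine h3.congr_deriv ?_
  field_simp

/-- **The substitution `t = log D/log x`** (Nathanson, proof of Theorem 9.5:
`−∫_w^z Ψ(log D/log u) d(log z/log u) = (log z/log D) ∫_{s}^{T} Ψ(t) dt` with `s = log D/log z`,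
`T = log D/log w`): for `1 < w ≤ z`, `Ψ` continuous on `ℝ` and any real `D` with `log D ≠ 0` (needed:
for `log D = 0` the left side is `Ψ(0) K (U(w) − U(z))` while the right side is `0`),
`∫_w^z Ψ(log D/log x) K log z dx/(x log² x) = K (log z/log D) ∫_{log D/log z}^{log D/log w} Ψ(t) dt`.
(The consumer, `JurkatRichertInduction.lean`, makes its `Ψ` globally continuous by a harmless `max`.)
[cite: Nathanson1996, Thm 9.5 (proof)] -/
theorem integral_comp_logRatio_mul_kTailDeriv {K w z D : ℝ} (hw : 1 < w) (hwz : w ≤ z)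
    (hD : Real.log D ≠ 0) {Ψ : ℝ → ℝ} (hΨ : Continuous Ψ) :
    ∫ x in w..z, Ψ (Real.log D / Real.log x) * kTailDeriv K z x =
      K * (Real.log z / Real.log D) *
        ∫ t in (Real.log D / Real.log z)..(Real.log D / Real.log w), Ψ t := by
  set f : ℝ → ℝ := fun y => Real.log D / Real.log y with hf
  set f' : ℝ → ℝ := fun y => -(Real.log D / (y * Real.log y ^ 2)) with hf'
  have hderiv : ∀ x ∈ uIcc w z, HasDerivAt f (f' x) x := by
    intro x hx
    rw [uIcc_of_le hwz] at hx
    exact hasDerivAt_logRatio D (hw.trans_le hx.1)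
  have hcont : ContinuousOn f' (uIcc w z) := by
    rw [uIcc_of_le hwz]
    have h : ContinuousOn (fun x : ℝ => x * Real.log x ^ 2) (Icc w z) :=
      continuousOn_mul_log_pow 2 (by linarith)
    exact (continuousOn_const.div h fun x hx => mul_log_pow_ne_zero 2 hw hx.1).neg
  have key := intervalIntegral.integral_comp_mul_deriv hderiv hcont hΨ
  -- `Ψ(f x) u(x) = -(K log z/log D) Ψ(f x) f'(x)`
  have hpt : ∀ x ∈ uIcc w z, Ψ (Real.log D / Real.log x) * kTailDeriv K z x =
      -(K * (Real.log z / Real.log D)) * ((Ψ ∘ f) x * f' x) := by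
    intro x hx
    rw [uIcc_of_le hwz] at hx
    have hx1 : 1 < x := hw.trans_le hx.1
    have hlog : 0 < Real.log x := Real.log_pos hx1
    have hx0 : (0 : ℝ) < x := by linarith
    simp only [Function.comp, hf, hf', kTailDeriv]
    field_simp
  rw [intervalIntegral.integral_congr hpt, intervalIntegral.integral_const_mul, key]
  simp only [hf]
  rw [intervalIntegral.integral_symm (Real.log D / Real.log z) (Real.log D / Real.log w)]
  ring

end BetaSieve

end Literature.NumberTheory.Sieve
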